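import Summits.CriticalPhenomena.PercolationContinuityZ3.Theorems.PercNearOneGluingNoHeavyLowerTailCILReduction
import Summits.CriticalPhenomena.PercolationContinuityZ3.Theorems.PercNearOneGluingNoHeavyLowerTailCILFour
import Summits.CriticalPhenomena.PercolationContinuityZ3.Theorems.PercNearOneGluingNoHeavyLowerTailAttachedChampionCardSubTwo
import HarnessLib

/-!
# `NoHeavyLowerTail` (stmt-CriticalPhenomena-4575) — a LOSSY relay-deletion induction closes the crux:
# the per-relay ratio step ("MONO-ρ") with loss factor `|A|/(|A|−1)`

Support file (prover `prim-lf-5`, lemma factory #5 "blob-quotient / deletion induction on `|A|`";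
`--supports stmt-CriticalPhenomena-4575`).  No definitions, no named facts, no sorries.

Notation: `μ = prodBernoulli w` on `Fin n`, relays `B`, observer `o`, level `j`,
`bad_j(B) = μ{1 ≤ |C(o) ∩ B| ≤ j}`, `I_j(B; a) = μ{|C(a) ∩ B| ≤ j}`.  The cumulative isolation lemma CIL_j
(`bad_j(A) ≤ max_a I_j(A; a)`, registered stub `stub_cumulativeIsolation`) closes the crux with constant `2`
(`…CILReduction`), and the landed reduction `noHeavyLowerTail_of_fatMinorityLinear` accepts ANY constant.  Every
EXACT one-step induction on `|A|` for CIL (Mono-E and all its variants) is refuted (crux evidence LF5-INDUCTION-NOGO.md: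
CIL is a maximum of linear functionals of the cluster law, hence convex under reductions).  This file records the
LOSSY induction that survives: it suffices that deleting ONE suitable relay from the relay set (graph untouched)
loses at most the factor `(|A|−1)/|A|` in the ratio `bad / max I`, because the losses telescope:
`∏_{m=j+3}^{k} m/(m−1) = k/(j+2) < 2` at the crux level `j = ⌊k/2⌋`, starting from the PROVED level `j = |A| − 2`
(`attachedChampion_level_card_sub_two`).

* `cumulativeIsolation_level_card_sub_two` — CIL at level `|A| − 2` (`|A| ≥ 3`), from the landed attached-champion
  inequality at that level applied to a lightness champion.
* `weakCIL_of_monoRhoStep` — **the telescoping induction**: under the relay-deletion step hypothesis `hStep`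
  (for every instance with `|A| ≥ j+3` and every `c ≥ 0`: if every `A.erase y` satisfies `bad_j ≤ c · I_j(·; a)` for
  some `a`, then `A` satisfies `bad_j ≤ (|A|/(|A|−1)) · c · I_j(A; a)` for some `a`), one has for all `|A| ≥ j+2 ≥ 3`:
  `∃ a ∈ A, bad_j(A) ≤ (|A|/(j+2)) · I_j(A; a)`.
* `twoCIL_half_of_monoRhoStep` — at the crux level: `∃ a ∈ A, μ{1 ≤ N ∧ 2N ≤ |A|} ≤ 2 · μ{2|π(a)| ≤ |A|}`
  (`|A| ≤ 4` from the landed `cumulativeIsolation_card_le_four`).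
* `fatMinorityLinear_of_twoCIL`, `noHeavyLowerTail_of_monoRhoStep` — `hStep ⇒ stub_fatMinorityLinear (d₀ = 0, C = 4)
  ⇒ NoHeavyLowerTail`.

The hypothesis `hStep` is implied (outside the degenerate case `max_{a≠y} I_j(A∖y; a) = 0`) by the conjecture
MONO-ρ-DS of the crux evidence LF5-CANDIDATES.md §A5: `∃ y ∈ A, |A|·bad_j(A∖y)·max_a I_j(A;a) ≥ (|A|−1)·bad_j(A)·
max_{a≠y} I_j(A∖y;a)` — exact-enumeration census: 0 violations at the cells `j ≥ ⌊|A|/2⌋` that this induction visits,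
supremum of the loss factor `→ |A|/(|A|−1)` from below along "observer weakly and evenly attached to a vertex-transitive
near-deterministic relay graph" (K5: 1.24875, K_{2,2,2}: 1.19997, C7(1,2): 1.16666); it FAILS below the ladder
((6,2): prism C3×K2, factor 1.39 > 6/5), which the induction never uses.
-/

noncomputable section

namespace Summit.CriticalPhenomena.PercolationContinuityZ3.Theorems

open MeasureTheory Set Literature.Probability.LatticeModels Literature.Probability.Percolation
open scoped Classical BigOperators

variable {n : ℕ}

/-- **CIL at level `|A| − 2`** (`|A| ≥ 3`): some relay `a ∈ A` has `μ{1 ≤ N ≤ |A|−2} ≤ μ{|π(a)| ≤ |A|−2}`.  From the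
landed attached-champion inequality at that level (`attachedChampion_level_card_sub_two`) applied to a champion
(`Finset.exists_max_image`), dropping the attachment event. -/
theorem cumulativeIsolation_level_card_sub_two (w : Sym2 (Fin n) → unitInterval) (A : Finset (Fin n)) (o : Fin n)
    (hk : 3 ≤ A.card) :
    ∃ a ∈ A,
      (prodBernoulli w).real {ω : BondConfig (Fin n) |
          1 ≤ (A.filter fun x => ω ∈ openConn o x).card ∧
            (A.filter fun x => ω ∈ openConn o x).card ≤ A.card - 2} ≤
        (prodBernoulli w).real {ω : BondConfig (Fin n) |
          (A.filter fun x => ω ∈ openConn a x).card ≤ A.card - 2} := by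
  have hA : A.Nonempty := Finset.card_pos.1 (by omega)
  obtain ⟨q, hq, hchamp⟩ := Finset.exists_max_image A
    (fun a => (prodBernoulli w).real {ω : BondConfig (Fin n) |
      (A.filter fun x => ω ∈ openConn a x).card ≤ A.card - 2}) hA
  refine ⟨q, hq, (attachedChampion_level_card_sub_two n w A o q hk hq hchamp).trans ?_⟩
  exact measureReal_mono (fun ω hω => hω.1) (measure_ne_top _ _)

/-- **The telescoping relay-deletion induction.**  Hypothesis `hStep` (the MONO-ρ step, loss `|A|/(|A|−1)`):
for every weighted graph, relay set `A` with `|A| ≥ j + 3`, observer `o ∉ A` and constant `c ≥ 0`, if for every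
`y ∈ A` some `a ∈ A.erase y` satisfies `bad_j(A.erase y) ≤ c · I_j(A.erase y; a)`, then some `a ∈ A` satisfies
`bad_j(A) ≤ (|A|/(|A|−1)) · c · I_j(A; a)`.  Conclusion: for every `j ≥ 1` and every `A` with `|A| ≥ j + 2`, `o ∉ A`,
some `a ∈ A` has `bad_j(A) ≤ (|A|/(j+2)) · I_j(A; a)`.  Induction on `|A| − (j+2)`; the base is CIL at level
`|A| − 2` (`cumulativeIsolation_level_card_sub_two`); the constants telescope. -/
theorem weakCIL_of_monoRhoStep
    (hStep : ∀ (j n : ℕ) (w : Sym2 (Fin n) → unitInterval) (A : Finset (Fin n)) (o : Fin n) (c : ℝ),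
      o ∉ A → j + 3 ≤ A.card → 0 ≤ c →
      (∀ y ∈ A, ∃ a ∈ A.erase y,
        (prodBernoulli w).real {ω : BondConfig (Fin n) |
            1 ≤ ((A.erase y).filter fun x => ω ∈ openConn o x).card ∧
              ((A.erase y).filter fun x => ω ∈ openConn o x).card ≤ j} ≤
          c * (prodBernoulli w).real {ω : BondConfig (Fin n) |
            ((A.erase y).filter fun x => ω ∈ openConn a x).card ≤ j}) →
      ∃ a ∈ A,
        (prodBernoulli w).real {ω : BondConfig (Fin n) |
            1 ≤ (A.filter fun x => ω ∈ openConn o x).card ∧ (A.filter fun x => ω ∈ openConn o x).card ≤ j} ≤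
          (A.card : ℝ) / ((A.card : ℝ) - 1) * c *
            (prodBernoulli w).real {ω : BondConfig (Fin n) | (A.filter fun x => ω ∈ openConn a x).card ≤ j})
    (j : ℕ) (hj : 1 ≤ j) :
    ∀ (m n : ℕ) (w : Sym2 (Fin n) → unitInterval) (A : Finset (Fin n)) (o : Fin n),
      o ∉ A → A.card = j + 2 + m →
      ∃ a ∈ A,
        (prodBernoulli w).real {ω : BondConfig (Fin n) |
            1 ≤ (A.filter fun x => ω ∈ openConn o x).card ∧ (A.filter fun x => ω ∈ openConn o x).card ≤ j} ≤
          ((A.card : ℝ) / ((j : ℝ) + 2)) *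
            (prodBernoulli w).real {ω : BondConfig (Fin n) | (A.filter fun x => ω ∈ openConn a x).card ≤ j} := by
  intro m
  induction m with
  | zero =>
    intro n w A o _ hcard
    have hk : 3 ≤ A.card := by omega
    obtain ⟨a, ha, hle⟩ := cumulativeIsolation_level_card_sub_two w A o hk
    refine ⟨a, ha, ?_⟩
    have hsub : A.card - 2 = j := by omega
    rw [hsub] at hle
    have hcoef : (A.card : ℝ) / ((j : ℝ) + 2) = 1 := by
      rw [hcard, Nat.add_zero]
      push_cast
      exact div_self (by positivity)
    rw [hcoef, one_mul]
    exact hle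
  | succ m ih =>
    intro n w A o ho hcard
    have hk : j + 3 ≤ A.card := by omega
    set c : ℝ := ((j : ℝ) + 2 + m) / ((j : ℝ) + 2) with hc
    have hc0 : 0 ≤ c := by rw [hc]; positivity
    have hsub : ∀ y ∈ A, ∃ a ∈ A.erase y,
        (prodBernoulli w).real {ω : BondConfig (Fin n) |
            1 ≤ ((A.erase y).filter fun x => ω ∈ openConn o x).card ∧
              ((A.erase y).filter fun x => ω ∈ openConn o x).card ≤ j} ≤
          c * (prodBernoulli w).real {ω : BondConfig (Fin n) |
            ((A.erase y).filter fun x => ω ∈ openConn a x).card ≤ j} := by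
      intro y hy
      have hcard' : (A.erase y).card = j + 2 + m := by
        rw [Finset.card_erase_of_mem hy]; omega
      have ho' : o ∉ A.erase y := fun h => ho (Finset.mem_of_mem_erase h)
      obtain ⟨a, ha, hle⟩ := ih n w (A.erase y) o ho' hcard'
      refine ⟨a, ha, ?_⟩
      have hcoef : ((A.erase y).card : ℝ) / ((j : ℝ) + 2) = c := by
        rw [hcard', hc]; push_cast; ring
      rw [hcoef] at hle
      exact hle
    obtain ⟨a, ha, hle⟩ := hStep j n w A o c ho hk hc0 hsub
    refine ⟨a, ha, hle.trans (le_of_eq ?_)⟩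
    have hk1 : ((A.card : ℝ) - 1) ≠ 0 := by
      have : (2 : ℝ) ≤ (A.card : ℝ) - 1 := by
        have h4 : (4 : ℝ) ≤ (A.card : ℝ) := by exact_mod_cast (show 4 ≤ A.card by omega)
        linarith
      linarith
    have hkm : (A.card : ℝ) - 1 = (j : ℝ) + 2 + m := by
      rw [hcard]; push_cast; ring
    rw [hc, ← hkm]
    field_simp

/-- **Two-CIL at the crux level.**  Under `hStep`, for every nonempty relay set `A` and observer `o ∉ A` some relay
`a ∈ A` satisfies `μ{1 ≤ N ∧ 2N ≤ |A|} ≤ 2 · μ{2|π(a)| ≤ |A|}`.  For `|A| ≤ 4` this is the landed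
`cumulativeIsolation_card_le_four` (constant `1`); for `|A| ≥ 5`, `weakCIL_of_monoRhoStep` at `j = ⌊|A|/2⌋` gives
the constant `|A|/(⌊|A|/2⌋+2) ≤ 2`. -/
theorem twoCIL_half_of_monoRhoStep
    (hStep : ∀ (j n : ℕ) (w : Sym2 (Fin n) → unitInterval) (A : Finset (Fin n)) (o : Fin n) (c : ℝ),
      o ∉ A → j + 3 ≤ A.card → 0 ≤ c →
      (∀ y ∈ A, ∃ a ∈ A.erase y,
        (prodBernoulli w).real {ω : BondConfig (Fin n) |
            1 ≤ ((A.erase y).filter fun x => ω ∈ openConn o x).card ∧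
              ((A.erase y).filter fun x => ω ∈ openConn o x).card ≤ j} ≤
          c * (prodBernoulli w).real {ω : BondConfig (Fin n) |
            ((A.erase y).filter fun x => ω ∈ openConn a x).card ≤ j}) →
      ∃ a ∈ A,
        (prodBernoulli w).real {ω : BondConfig (Fin n) |
            1 ≤ (A.filter fun x => ω ∈ openConn o x).card ∧ (A.filter fun x => ω ∈ openConn o x).card ≤ j} ≤
          (A.card : ℝ) / ((A.card : ℝ) - 1) * c *
            (prodBernoulli w).real {ω : BondConfig (Fin n) | (A.filter fun x => ω ∈ openConn a x).card ≤ j}) :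
    ∀ (n : ℕ) (w : Sym2 (Fin n) → unitInterval) (A : Finset (Fin n)) (o : Fin n),
      A.Nonempty → o ∉ A → ∃ a ∈ A,
        (prodBernoulli w).real {ω : BondConfig (Fin n) |
            1 ≤ (A.filter fun x => ω ∈ openConn o x).card ∧
              2 * (A.filter fun x => ω ∈ openConn o x).card ≤ A.card} ≤
          2 * (prodBernoulli w).real {ω : BondConfig (Fin n) |
            2 * (A.filter fun x => ω ∈ openConn a x).card ≤ A.card} := by
  intro n w A o hA ho
  set j := A.card / 2 with hjdef
  -- the half-level events are the level-`j` events
  have hevo : {ω : BondConfig (Fin n) |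
      1 ≤ (A.filter fun x => ω ∈ openConn o x).card ∧ 2 * (A.filter fun x => ω ∈ openConn o x).card ≤ A.card} =
      {ω : BondConfig (Fin n) |
        1 ≤ (A.filter fun x => ω ∈ openConn o x).card ∧ (A.filter fun x => ω ∈ openConn o x).card ≤ j} := by
    ext ω; simp only [Set.mem_setOf_eq]; omega
  have heva : ∀ a : Fin n, {ω : BondConfig (Fin n) | 2 * (A.filter fun x => ω ∈ openConn a x).card ≤ A.card} =
      {ω : BondConfig (Fin n) | (A.filter fun x => ω ∈ openConn a x).card ≤ j} := by
    intro a; ext ω; simp only [Set.mem_setOf_eq]; omega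
  rcases Nat.lt_or_ge A.card 5 with h4 | h5
  · obtain ⟨a, ha, hle⟩ := cumulativeIsolation_card_le_four n w A o j (by omega) hA ho
    refine ⟨a, ha, ?_⟩
    rw [hevo, heva a]
    have hnn : 0 ≤ (prodBernoulli w).real {ω : BondConfig (Fin n) | (A.filter fun x => ω ∈ openConn a x).card ≤ j} :=
      measureReal_nonneg
    linarith
  · have hj : 1 ≤ j := by omega
    have hm : A.card = j + 2 + (A.card - (j + 2)) := by omega
    obtain ⟨a, ha, hle⟩ := weakCIL_of_monoRhoStep hStep j hj (A.card - (j + 2)) n w A o ho hm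
    refine ⟨a, ha, ?_⟩
    rw [hevo, heva a]
    have hnn : 0 ≤ (prodBernoulli w).real {ω : BondConfig (Fin n) | (A.filter fun x => ω ∈ openConn a x).card ≤ j} :=
      measureReal_nonneg
    have hcoef : (A.card : ℝ) / ((j : ℝ) + 2) ≤ 2 := by
      have h2 : (A.card : ℝ) ≤ 2 * ((j : ℝ) + 2) := by
        have : A.card ≤ 2 * (j + 2) := by omega
        exact_mod_cast this
      rw [div_le_iff₀ (by positivity)]
      linarith
    exact hle.trans (mul_le_mul_of_nonneg_right hcoef hnn)

/-- **Two-CIL ⇒ the fat-minority linear bound (`d₀ = 0`, `C = 4`).**  As in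
`fatMinorityLinear_of_cumulativeIsolation`, with the constant doubled: pair counting (`smallBlock_le_two_mul`)
bounds `μ{2|π(a)| ≤ |A|}` by `2η`. -/
theorem fatMinorityLinear_of_twoCIL
    (h2CIL : ∀ (n : ℕ) (w : Sym2 (Fin n) → unitInterval) (A : Finset (Fin n)) (o : Fin n),
      A.Nonempty → o ∉ A → ∃ a ∈ A,
        (prodBernoulli w).real {ω : BondConfig (Fin n) |
            1 ≤ (A.filter fun x => ω ∈ openConn o x).card ∧
              2 * (A.filter fun x => ω ∈ openConn o x).card ≤ A.card} ≤
          2 * (prodBernoulli w).real {ω : BondConfig (Fin n) |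
            2 * (A.filter fun x => ω ∈ openConn a x).card ≤ A.card}) :
    ∃ (d₀ : ℕ) (C : ℝ), 0 ≤ C ∧ ∀ (n : ℕ) (w : Sym2 (Fin n) → unitInterval) (A : Finset (Fin n))
      (o : Fin n) (η : ℝ), 0 ≤ η → o ∉ A →
      (∀ a ∈ A, ∀ a' ∈ A, (Literature.Probability.LatticeModels.prodBernoulli w).real
        (Literature.Probability.Percolation.openConn a a')ᶜ ≤ η) →
      (Literature.Probability.LatticeModels.prodBernoulli w).real
          {ω : Literature.Probability.Percolation.BondConfig (Fin n) |
            d₀ < (A.filter fun a => ω ∈ Literature.Probability.Percolation.openConn o a).card ∧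
              2 * (A.filter fun a => ω ∈ Literature.Probability.Percolation.openConn o a).card ≤
                A.card} ≤
        C * ((Literature.Probability.LatticeModels.prodBernoulli w).real
          (⋃ a ∈ A, Literature.Probability.Percolation.openConn o a)ᶜ + η) := by
  refine ⟨0, 4, by norm_num, fun n w A o η hη ho hpair => ?_⟩
  have hcompl : 0 ≤ (prodBernoulli w).real (⋃ a ∈ A, (openConn o a : Set (BondConfig (Fin n))))ᶜ :=
    measureReal_nonneg
  rcases A.eq_empty_or_nonempty with hAe | hAne
  · have hempty : {ω : BondConfig (Fin n) |
        0 < (A.filter fun a => ω ∈ openConn o a).card ∧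
          2 * (A.filter fun a => ω ∈ openConn o a).card ≤ A.card} = ∅ := by
      ext ω
      simp [hAe]
    rw [hempty, measureReal_empty]
    nlinarith
  · obtain ⟨a, ha, hle⟩ := h2CIL n w A o hAne ho
    have h2 := smallBlock_le_two_mul w A a η ha (fun a' ha' => hpair a ha a' ha')
    have hev : {ω : BondConfig (Fin n) |
        0 < (A.filter fun a => ω ∈ openConn o a).card ∧
          2 * (A.filter fun a => ω ∈ openConn o a).card ≤ A.card} =
        {ω : BondConfig (Fin n) |
          1 ≤ (A.filter fun x => ω ∈ openConn o x).card ∧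
            2 * (A.filter fun x => ω ∈ openConn o x).card ≤ A.card} := by
      ext ω; simp only [Set.mem_setOf_eq]; omega
    rw [hev]
    linarith

/-- **The MONO-ρ relay-deletion step closes the crux `NoHeavyLowerTail`** (through
`twoCIL_half_of_monoRhoStep`, `fatMinorityLinear_of_twoCIL` with `C = 4`, and the landed
`noHeavyLowerTail_of_fatMinorityLinear`).  The hypothesis is the typed residual of the lossy blob-quotient /
relay-deletion induction: a loss factor `|A|/(|A|−1)` per deleted relay is affordable because it telescopes. -/
theorem noHeavyLowerTail_of_monoRhoStep
    (hStep : ∀ (j n : ℕ) (w : Sym2 (Fin n) → unitInterval) (A : Finset (Fin n)) (o : Fin n) (c : ℝ),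
      o ∉ A → j + 3 ≤ A.card → 0 ≤ c →
      (∀ y ∈ A, ∃ a ∈ A.erase y,
        (prodBernoulli w).real {ω : BondConfig (Fin n) |
            1 ≤ ((A.erase y).filter fun x => ω ∈ openConn o x).card ∧
              ((A.erase y).filter fun x => ω ∈ openConn o x).card ≤ j} ≤
          c * (prodBernoulli w).real {ω : BondConfig (Fin n) |
            ((A.erase y).filter fun x => ω ∈ openConn a x).card ≤ j}) →
      ∃ a ∈ A,
        (prodBernoulli w).real {ω : BondConfig (Fin n) |
            1 ≤ (A.filter fun x => ω ∈ openConn o x).card ∧ (A.filter fun x => ω ∈ openConn o x).card ≤ j} ≤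
          (A.card : ℝ) / ((A.card : ℝ) - 1) * c *
            (prodBernoulli w).real {ω : BondConfig (Fin n) | (A.filter fun x => ω ∈ openConn a x).card ≤ j}) :
    Summit.CriticalPhenomena.PercolationContinuityZ3.Theses.PercNearOneGluing.NoHeavyLowerTail :=
  noHeavyLowerTail_of_fatMinorityLinear (fatMinorityLinear_of_twoCIL (twoCIL_half_of_monoRhoStep hStep))

end Summit.CriticalPhenomena.PercolationContinuityZ3.Theorems

end
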